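import Summits.Ventures.CertifiedArithmetic.LowPrec.AccumulateRange
import Summits.Ventures.CertifiedArithmetic.LowPrec.JRBridge

/-!
# Two-level (blocked, split-K) accumulation with two accumulator formats

HONEST FRAMING (venture CertifiedArithmetic / cell `pub-lowprec`): certified error envelopes and
provably optimal rounding/accumulation schemes for low-precision formats under stated cost models;
every table by two implementations; no hardware or vendor claims.

The GEMM model's blocked orders ("blocked split-K": partial sums of blocks in one accumulator
format `α`, e.g. `binary16`/`bfloat16`, then the block results combined in a second format `β`, e.g.
`binary32`; cf. the block-FMA analyses of [BlanchardHighamLopezMaryPranesh2020]). Inner blocks are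
arbitrary evaluation trees `tⱼ` in `α` (leaves = exact products, values of `α`), the outer
combination is an arbitrary evaluation tree `T` in `β` whose leaves are the computed block values.
PROVED (`abs_twoLevel_sub_exact_le`): if every value of `α` is a value of `β`, inner nodes are in
range in `α` and outer nodes in range in `β`, then
`|ŝ - s| ≤ [ (K-1)·u_α' + (B-1)·u_β'·(1 + (K-1)·u_α') ] · Σ|xᵢ|`,
`K` = largest block (leaf count), `B` = number of blocks, `u' = u/(1+u)` of the respective format —
the two Jeannerod–Rump constants composed, no `O(u²)` slack beyond the explicit cross term.
Format embeddings for the instances: every `binary16` / `bfloat16` / FP8 value is a `binary32` value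
(`exists_toRat_Binary32_of_Binary16`, `…_of_BFloat16`).
-/

namespace Literature.ComputerArithmetic.FloatingPoint

namespace MiniFloat

open Literature.ComputerArithmetic.JeannerodRump2018
open Literature.ComputerArithmetic.JeannerodRump2018.SumTree

variable {α β : Format}

/-! ### List bookkeeping -/

/-- The exact sum of a tree is the sum of its leaves. [folklore] -/
theorem exact_eq_sum_leaves : ∀ t : SumTree, SumTree.exact t = t.leaves.sum
  | .leaf x => by simp [SumTree.exact, SumTree.leaves]
  | .node l r => by
      rw [SumTree.exact, exact_eq_sum_leaves l, exact_eq_sum_leaves r]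
      simp [SumTree.leaves, List.sum_append]

/-- Termwise comparison of mapped sums. [folklore] -/
theorem sum_map_le_sum_map {ι : Type*} (l : List ι) (f g : ι → ℚ) (h : ∀ i ∈ l, f i ≤ g i) :
    (l.map f).sum ≤ (l.map g).sum := by
  induction l with
  | nil => simp
  | cons a l ih =>
      simp only [List.map_cons, List.sum_cons]
      exact add_le_add (h a (by simp)) (ih fun i hi => h i (by simp [hi]))

/-- `|Σ fᵢ - Σ gᵢ| ≤ Σ |fᵢ - gᵢ|`. [folklore] -/
theorem abs_sum_map_sub_le {ι : Type*} (l : List ι) (f g : ι → ℚ) :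
    |(l.map f).sum - (l.map g).sum| ≤ (l.map fun i => |f i - g i|).sum := by
  induction l with
  | nil => simp
  | cons a l ih =>
      simp only [List.map_cons, List.sum_cons]
      calc |f a + (l.map f).sum - (g a + (l.map g).sum)|
          = |(f a - g a) + ((l.map f).sum - (l.map g).sum)| := by ring_nf
        _ ≤ |f a - g a| + |(l.map f).sum - (l.map g).sum| := abs_add_le _ _
        _ ≤ |f a - g a| + (l.map fun i => |f i - g i|).sum := by linarith

/-- Pulling a constant out of a mapped sum. [folklore] -/
theorem sum_map_const_mul {ι : Type*} (l : List ι) (c : ℚ) (f : ι → ℚ) :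
    (l.map fun i => c * f i).sum = c * (l.map f).sum := by
  induction l with
  | nil => simp
  | cons a l ih => simp only [List.map_cons, List.sum_cons, ih]; ring

/-- A mapped sum of nonnegative terms is nonnegative. [folklore] -/
theorem sum_map_nonneg {ι : Type*} (l : List ι) (f : ι → ℚ) (h : ∀ i ∈ l, 0 ≤ f i) :
    0 ≤ (l.map f).sum := by
  induction l with
  | nil => simp
  | cons a l ih =>
      simp only [List.map_cons, List.sum_cons]
      exact add_nonneg (h a (by simp)) (ih fun i hi => h i (by simp [hi]))

/-! ### The two-level bound -/

/-- TWO-LEVEL BLOCKED ACCUMULATION (split-K, two formats): inner blocks `tⱼ` evaluated in `α`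
(leaves in `F_α`, nodes in range, at most `K` leaves each), their computed values — values of `α`,
assumed to be values of `β` — combined by an outer tree `T` evaluated in `β` (nodes in range). Then
`|ŝ - Σⱼ sⱼ| ≤ [(K-1)u_α' + (B-1)u_β'(1 + (K-1)u_α')]·Σⱼ Σ|xᵢ|`, `B` = number of blocks,
`u' = u/(1+u)`. [cite: BlanchardHighamLopezMaryPranesh2020, §3 (block FMA model; here both levels
are plain rounded additions)] -/
theorem abs_twoLevel_sub_exact_le (hα : 2 ≤ α.emaxCode) (hβ : 2 ≤ β.emaxCode)
    (ts : List SumTree) (T : SumTree) (K : ℕ)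
    (hT : T.leaves = ts.map (SumTree.eval (flα α)))
    (hinner : ∀ t ∈ ts, TreeInRange α t) (hK : ∀ t ∈ ts, t.leaves.length ≤ K)
    (houter : TreeInRange β T) :
    |SumTree.eval (flα β) T - (ts.map SumTree.exact).sum|
      ≤ (((K : ℚ) - 1) * (α.unitRoundoff / (1 + α.unitRoundoff))
          + ((ts.length : ℚ) - 1) * (β.unitRoundoff / (1 + β.unitRoundoff))
            * (1 + ((K : ℚ) - 1) * (α.unitRoundoff / (1 + α.unitRoundoff))))
        * (ts.map absSum).sum := by
  set ua := α.unitRoundoff / (1 + α.unitRoundoff) with hua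
  set ub := β.unitRoundoff / (1 + β.unitRoundoff) with hub
  have hua0 : 0 ≤ ua := div_nonneg α.unitRoundoff_pos.le (by linarith [α.unitRoundoff_pos])
  have hub0 : 0 ≤ ub := div_nonneg β.unitRoundoff_pos.le (by linarith [β.unitRoundoff_pos])
  set L := (ts.map absSum).sum with hL
  have hL0 : 0 ≤ L := sum_map_nonneg ts absSum fun t _ => absSum_nonneg t
  -- every block has at least one leaf, so K ≥ 1 as soon as there is a block
  have hK1 : ∀ t ∈ ts, (1 : ℚ) ≤ K := fun t ht => by
    have := one_le_length_leaves t; have := hK t ht; exact_mod_cast (by omega : 1 ≤ K)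
  -- (a) inner errors: Σⱼ |ŝⱼ - sⱼ| ≤ (K-1)·ua·L
  have hin : (ts.map fun t => |SumTree.eval (flα α) t - SumTree.exact t|).sum
      ≤ ((K : ℚ) - 1) * ua * L := by
    rw [hL, ← sum_map_const_mul]
    refine sum_map_le_sum_map ts _ _ fun t ht => ?_
    have h1 := abs_eval_sub_exact_le_sharp hα t (hinner t ht)
    have h2 : ((t.leaves.length : ℚ) - 1) * ua * absSum t ≤ ((K : ℚ) - 1) * ua * absSum t := by
      apply mul_le_mul_of_nonneg_right _ (absSum_nonneg t)
      apply mul_le_mul_of_nonneg_right _ hua0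
      have := hK t ht
      have : (t.leaves.length : ℚ) ≤ K := by exact_mod_cast this
      linarith
    exact le_trans h1 h2
  -- (b) the outer leaf sum: Σⱼ |ŝⱼ| ≤ (1 + (K-1)·ua)·L
  have hleaf : absSum T ≤ (1 + ((K : ℚ) - 1) * ua) * L := by
    have e : absSum T = (ts.map fun t => |SumTree.eval (flα α) t|).sum := by
      rw [absSum, hT, List.map_map]; rfl
    rw [e, hL, ← sum_map_const_mul]
    refine sum_map_le_sum_map ts _ _ fun t ht => ?_
    have h1 := abs_eval_le_of_treeInRange hα t (hinner t ht)
    refine le_trans h1 (mul_le_mul_of_nonneg_right ?_ (absSum_nonneg t))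
    have := hK t ht
    have : (t.leaves.length : ℚ) ≤ K := by exact_mod_cast this
    nlinarith
  -- (c) outer error ≤ (B-1)·ub·absSum T
  have hout := abs_eval_sub_exact_le_sharp hβ T houter
  have hB : (T.leaves.length : ℚ) = ts.length := by rw [hT, List.length_map]
  rw [hB] at hout
  -- (d) exact T = Σⱼ ŝⱼ and |Σⱼ ŝⱼ - Σⱼ sⱼ| ≤ Σⱼ |ŝⱼ - sⱼ|
  have hexT : SumTree.exact T = (ts.map (SumTree.eval (flα α))).sum := by
    rw [exact_eq_sum_leaves, hT]
  have hdiff := abs_sum_map_sub_le ts (SumTree.eval (flα α)) SumTree.exact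
  -- assemble
  have hB1 : (0 : ℚ) ≤ (ts.length : ℚ) - 1 ∨ ts = [] := by
    cases ts with
    | nil => exact Or.inr rfl
    | cons a l => left; simp
  have key : |SumTree.eval (flα β) T - (ts.map SumTree.exact).sum|
      ≤ |SumTree.eval (flα β) T - SumTree.exact T|
        + |(ts.map (SumTree.eval (flα α))).sum - (ts.map SumTree.exact).sum| := by
    rw [← hexT]
    calc |SumTree.eval (flα β) T - (ts.map SumTree.exact).sum|
        = |(SumTree.eval (flα β) T - SumTree.exact T)
            + (SumTree.exact T - (ts.map SumTree.exact).sum)| := by ring_nf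
      _ ≤ _ := abs_add_le _ _
  rcases hB1 with hB1 | hnil
  · have hout' : |SumTree.eval (flα β) T - SumTree.exact T|
        ≤ ((ts.length : ℚ) - 1) * ub * ((1 + ((K : ℚ) - 1) * ua) * L) :=
      le_trans hout (mul_le_mul_of_nonneg_left hleaf (mul_nonneg hB1 hub0))
    calc |SumTree.eval (flα β) T - (ts.map SumTree.exact).sum|
        ≤ ((ts.length : ℚ) - 1) * ub * ((1 + ((K : ℚ) - 1) * ua) * L) + ((K : ℚ) - 1) * ua * L := by
          linarith [le_trans hdiff hin]
      _ = (((K : ℚ) - 1) * ua + ((ts.length : ℚ) - 1) * ub * (1 + ((K : ℚ) - 1) * ua)) * L := by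
          ring
  · -- no blocks: `T` has no leaves, impossible (a tree has ≥ 1 leaf)
    subst hnil
    exfalso
    have h1 := one_le_length_leaves T
    rw [hT] at h1
    simp at h1

/-! ### Format embeddings for the instances -/

/-- Every `binary16` value is a `binary32` value. [cite: IEEE7542019, §3.6] -/
theorem exists_toRat_Binary32_of_Binary16 (y : MiniFloat Format.Binary16) :
    ∃ z : MiniFloat Format.Binary32, z.toRat = y.toRat := by
  obtain ⟨M, e, hM, he, hy⟩ := isFloat_toRat y
  refine exists_toRat_eq_of_isFloat ⟨M, e, lt_of_lt_of_le hM ?_, le_trans ?_ he, hy⟩ ?_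
  · exact_mod_cast (by decide : 2 ^ (10 + 1) ≤ 2 ^ (23 + 1))
  · decide
  · exact le_trans (abs_toRat_le_maxRat y)
      (by rw [Format.Binary16_maxRat.1, Format.Binary32_maxRat.1]; norm_num)

/-- Every `bfloat16` value is a `binary32` value. [cite: BlanchardHighamLopezMaryPranesh2020, §2] -/
theorem exists_toRat_Binary32_of_BFloat16 (y : MiniFloat Format.BFloat16) :
    ∃ z : MiniFloat Format.Binary32, z.toRat = y.toRat := by
  obtain ⟨M, e, hM, he, hy⟩ := isFloat_toRat y
  refine exists_toRat_eq_of_isFloat ⟨M, e, lt_of_lt_of_le hM ?_, le_trans ?_ he, hy⟩ ?_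
  · exact_mod_cast (by decide : 2 ^ (7 + 1) ≤ 2 ^ (23 + 1))
  · decide
  · exact le_trans (abs_toRat_le_maxRat y)
      (by rw [Format.BFloat16_maxRat.1, Format.Binary32_maxRat.1]; norm_num)

/-- SPLIT-K WITH `binary16` BLOCKS AND `binary32` COMBINATION: constants `u₁₆' = 2^-11/(1+2^-11)`,
`u₃₂' = 2^-24/(1+2^-24)`: `|ŝ - s| ≤ [(K-1)u₁₆' + (B-1)u₃₂'(1 + (K-1)u₁₆')]·Σ|xᵢ|`. [folklore] -/
theorem abs_twoLevel_Binary16_Binary32 (ts : List SumTree) (T : SumTree) (K : ℕ)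
    (hT : T.leaves = ts.map (SumTree.eval (flα Format.Binary16)))
    (hinner : ∀ t ∈ ts, TreeInRange Format.Binary16 t) (hK : ∀ t ∈ ts, t.leaves.length ≤ K)
    (houter : TreeInRange Format.Binary32 T) :
    |SumTree.eval (flα Format.Binary32) T - (ts.map SumTree.exact).sum|
      ≤ (((K : ℚ) - 1) * (Format.Binary16.unitRoundoff / (1 + Format.Binary16.unitRoundoff))
          + ((ts.length : ℚ) - 1)
            * (Format.Binary32.unitRoundoff / (1 + Format.Binary32.unitRoundoff))
            * (1 + ((K : ℚ) - 1)
              * (Format.Binary16.unitRoundoff / (1 + Format.Binary16.unitRoundoff))))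
        * (ts.map absSum).sum :=
  abs_twoLevel_sub_exact_le (by decide) (by decide) ts T K hT hinner hK houter

end MiniFloat

end Literature.ComputerArithmetic.FloatingPoint
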